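import Mathlib.Data.Fintype.Pigeonhole
import Mathlib.Data.Fintype.Pi
import Mathlib.Data.Fintype.Prod
import Mathlib.Data.Fintype.BigOperators
import Literature.Computability.Cryptography.WordRAMBounds
import Literature.Computability.Cryptography.WordRAMExec
import Literature.Computability.Cryptography.WordRAMProofs
import HarnessLib

/-!
# The word RAM — clamped runs and eventual periodicity of oracle-free programs

Two elementary facts about runs of the concrete word RAM of
`Literature.Computability.Cryptography.WordRAM`, used by the refutation of the vendored transfer
property `FGReducible.trulySubTime` (`Literature.Computability.Cryptography.FGComplexity`):

* `stepTotal`, `runTotal`: the *clamped* run (one step, or stay put once halted), the form in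
  which a universal program simulates another program for a fixed number of rounds;
  `haltsWithin_iff_runTotal`, `outputsWithin_iff_runTotal`: time-bounded halting/output in terms
  of the clamped run.
* `stateBound P w := |P| · (V + 1) ^ (V + 1) + 1` with `V := valueBound P w`
  (`Literature.Computability.Cryptography.WordRAMBounds`): a deterministic oracle-free program
  run at word size `w` is a finite-state system — its program counter is `< |P|` before the last
  step and its memory is `V`-bounded and constant above address `V` — so by the pigeonhole
  principle a run that has not halted within `stateBound P w` steps revisits a configuration and
  never halts: `HaltsWithin.stateBound`, `OutputsWithin.stateBound` (whatever halts, halts within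
  `stateBound P w` steps). This is the folklore "a space-`S` machine halts within `2^{O(S)}` steps
  or loops forever" (e.g. Arora–Barak, *Computational Complexity*, 2009, proof of Thm. 4.2 —
  configuration graphs), specialised to the word RAM.

## References

* S. Arora, B. Barak, *Computational Complexity: A Modern Approach*, CUP 2009, §4.1
  (configuration graphs of space-bounded machines).
* V. Vassilevska Williams, *On some fine-grained questions in algorithms and complexity*,
  Proc. ICM 2018, §2 (the word-RAM model).
-/

namespace Literature.Computability.Cryptography.WordRAM

open StateTransition

/-! ## Clamped runs -/

section total

variable (P : Program) (w : ℕ) (O : List ℕ → List ℕ) (ρ : ℕ → ℕ)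

/-- One *clamped* step: the successor configuration, or the configuration itself if it is halted.
[folklore] -/
def stepTotal (c : Cfg) : Cfg :=
  (step P w O ρ c).getD c

/-- The clamped run: `n` clamped steps. [folklore] -/
def runTotal (n : ℕ) (c : Cfg) : Cfg :=
  (stepTotal P w O ρ)^[n] c

/-- Zero clamped steps. [folklore] -/
@[simp] theorem runTotal_zero (c : Cfg) : runTotal P w O ρ 0 c = c := rfl

/-- One more clamped step, taken first. [folklore] -/
theorem runTotal_succ (n : ℕ) (c : Cfg) :
    runTotal P w O ρ (n + 1) c = runTotal P w O ρ n (stepTotal P w O ρ c) := by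
  rw [runTotal, Function.iterate_succ_apply]; rfl

/-- One more clamped step, taken last. [folklore] -/
theorem runTotal_succ' (n : ℕ) (c : Cfg) :
    runTotal P w O ρ (n + 1) c = stepTotal P w O ρ (runTotal P w O ρ n c) := by
  rw [runTotal, Function.iterate_succ_apply']; rfl

/-- Clamped runs compose. [folklore] -/
theorem runTotal_add (m n : ℕ) (c : Cfg) :
    runTotal P w O ρ (m + n) c = runTotal P w O ρ n (runTotal P w O ρ m c) := by
  rw [runTotal, runTotal, runTotal, Nat.add_comm, Function.iterate_add_apply]

/-- A clamped step from a non-halted configuration is a step. [folklore] -/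
theorem stepTotal_of_step {c c' : Cfg} (h : step P w O ρ c = some c') : stepTotal P w O ρ c = c' := by
  simp [stepTotal, h]

/-- A halted configuration is fixed by clamped steps. [folklore] -/
theorem stepTotal_of_step_eq_none {c : Cfg} (h : step P w O ρ c = none) : stepTotal P w O ρ c = c := by
  simp [stepTotal, h]

/-- A halted configuration is fixed by clamped runs. [folklore] -/
theorem runTotal_of_step_eq_none {c : Cfg} (h : step P w O ρ c = none) (n : ℕ) :
    runTotal P w O ρ n c = c := by
  induction n with
  | zero => rfl
  | succ n ih => rw [runTotal_succ, stepTotal_of_step_eq_none _ _ _ _ h, ih]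

/-- A genuine run segment is a clamped run segment. [folklore] -/
theorem runTotal_of_run {n : ℕ} {c c' : Cfg} (h : run P w O ρ n c = some c') :
    runTotal P w O ρ n c = c' := by
  induction n generalizing c with
  | zero => simpa using h
  | succ n ih =>
    rw [run_succ] at h
    cases hs : step P w O ρ c with
    | none => rw [hs] at h; simp at h
    | some d =>
      rw [hs, Option.bind_some] at h
      rw [runTotal_succ, stepTotal_of_step _ _ _ _ hs, ih h]

/-- **The clamped run versus the run.** After `n` clamped steps, either the run is still alive and
agrees with the clamped run, or it halted at some earlier time `m ≤ n` in the configuration the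
clamped run has been stuck in since. [folklore] -/
theorem run_or_halted (n : ℕ) (c : Cfg) :
    run P w O ρ n c = some (runTotal P w O ρ n c) ∨
      ∃ m, m ≤ n ∧ run P w O ρ m c = some (runTotal P w O ρ n c) ∧
        step P w O ρ (runTotal P w O ρ n c) = none := by
  induction n with
  | zero => exact Or.inl rfl
  | succ n ih =>
    rcases ih with h | ⟨m, hm, hrun, hstep⟩
    · cases hs : step P w O ρ (runTotal P w O ρ n c) with
      | none =>
        refine Or.inr ⟨n, n.le_succ, ?_, ?_⟩
        · rw [runTotal_succ', stepTotal_of_step_eq_none _ _ _ _ hs, h]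
        · rw [runTotal_succ', stepTotal_of_step_eq_none _ _ _ _ hs, hs]
      | some d =>
        left
        rw [run_add_of_run _ _ _ _ h (by rw [run_one, hs]), runTotal_succ',
          stepTotal_of_step _ _ _ _ hs]
    · refine Or.inr ⟨m, by omega, ?_, ?_⟩
      · rw [runTotal_succ', stepTotal_of_step_eq_none _ _ _ _ hstep, hrun]
      · rw [runTotal_succ', stepTotal_of_step_eq_none _ _ _ _ hstep, hstep]

end total

/-- **Halting in terms of the clamped run**: `P` halts within `t` steps in `c` iff the clamped
run is at `c` after `t` rounds and `c` is halted. [folklore] -/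
theorem haltsWithin_iff_runTotal (P : Program) (w : ℕ) (O : List ℕ → List ℕ) (ρ : ℕ → ℕ)
    (x : List ℕ) (t : ℕ) (c : Cfg) :
    HaltsWithin P w O ρ x t c ↔ runTotal P w O ρ t (init w x) = c ∧ c.pc = none := by
  constructor
  · intro h
    obtain ⟨s, hs, hrun, hc⟩ := h.exists_run
    refine ⟨?_, (step_eq_none_iff P w O ρ c).1 hc⟩
    obtain ⟨d, rfl⟩ := Nat.exists_eq_add_of_le hs
    rw [runTotal_add, runTotal_of_run _ _ _ _ hrun, runTotal_of_step_eq_none _ _ _ _ hc]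
  · rintro ⟨hrun, hpc⟩
    have hc : step P w O ρ c = none := (step_eq_none_iff P w O ρ c).2 hpc
    rcases run_or_halted P w O ρ t (init w x) with h | ⟨m, hm, h, -⟩
    · rw [hrun] at h; exact haltsWithin_of_run h hc le_rfl
    · rw [hrun] at h; exact haltsWithin_of_run h hc hm

/-- **Output in terms of the clamped run**: `P` outputs `out` within `t` steps iff after `t`
clamped rounds the configuration is halted with `readOut = out`. [folklore] -/
theorem outputsWithin_iff_runTotal (P : Program) (w : ℕ) (O : List ℕ → List ℕ) (ρ : ℕ → ℕ)
    (x out : List ℕ) (t : ℕ) :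
    OutputsWithin P w O ρ x out t ↔
      (runTotal P w O ρ t (init w x)).pc = none ∧ readOut (runTotal P w O ρ t (init w x)).mem = out := by
  rw [outputsWithin_iff_exists_haltsWithin]
  constructor
  · rintro ⟨c, hc, hout⟩
    obtain ⟨rfl, hpc⟩ := (haltsWithin_iff_runTotal P w O ρ x t c).1 hc
    exact ⟨hpc, hout⟩
  · rintro ⟨hpc, hout⟩
    exact ⟨_, (haltsWithin_iff_runTotal P w O ρ x t _).2 ⟨rfl, hpc⟩, hout⟩

/-! ## Deterministic oracle-free programs: the configuration is (pc, memory) -/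

/-- A deterministic oracle-free program never moves the coin position or the query log. [folklore] -/
theorem step_coinPos_queries {P : Program} (hd : P.IsDeterministic) (ho : P.IsOracleFree) {w : ℕ}
    {O : List ℕ → List ℕ} {ρ : ℕ → ℕ} {c c' : Cfg} (h : step P w O ρ c = some c') :
    c'.coinPos = c.coinPos ∧ c'.queries = c.queries := by
  unfold step at h
  cases hpc : c.pc with
  | none => simp [hpc] at h
  | some i =>
    simp only [hpc] at h
    cases hI : P[i]? with
    | none => simp only [hI, Option.some.injEq] at h; subst h; exact ⟨rfl, rfl⟩
    | some I =>
      simp only [hI] at h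
      cases I with
      | halt => simp only [Option.some.injEq] at h; subst h; exact ⟨rfl, rfl⟩
      | jmp t => simp only [Option.some.injEq] at h; subst h; exact ⟨rfl, rfl⟩
      | jz y t => simp only [Option.some.injEq] at h; subst h; exact ⟨rfl, rfl⟩
      | op o dst y z => simp only [Option.some.injEq] at h; subst h; exact ⟨rfl, rfl⟩
      | rand dst =>
        have := hd _ (List.mem_of_getElem? hI)
        simp [Instr.isRand] at this
      | query qa ql aa =>
        have := ho _ (List.mem_of_getElem? hI)
        simp [Instr.isQuery] at this

/-- Along a run of a deterministic oracle-free program, coin position and query log are constant.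
[folklore] -/
theorem run_coinPos_queries {P : Program} (hd : P.IsDeterministic) (ho : P.IsOracleFree) {w : ℕ}
    {O : List ℕ → List ℕ} {ρ : ℕ → ℕ} :
    ∀ (n : ℕ) {c c' : Cfg}, run P w O ρ n c = some c' →
      c'.coinPos = c.coinPos ∧ c'.queries = c.queries
  | 0, c, c', h => by simp at h; subst h; exact ⟨rfl, rfl⟩
  | n + 1, c, c', h => by
    rw [run_succ] at h
    cases hs : step P w O ρ c with
    | none => rw [hs] at h; simp at h
    | some d =>
      rw [hs, Option.bind_some] at h
      obtain ⟨h1, h2⟩ := run_coinPos_queries hd ho n h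
      obtain ⟨h3, h4⟩ := step_coinPos_queries hd ho hs
      exact ⟨h1.trans h3, h2.trans h4⟩

/-- If a run is alive at time `n`, it is alive at every earlier time. [folklore] -/
theorem exists_run_of_le {P : Program} {w : ℕ} {O : List ℕ → List ℕ} {ρ : ℕ → ℕ} {c c' : Cfg}
    {m n : ℕ} (h : run P w O ρ n c = some c') (hmn : m ≤ n) : ∃ d, run P w O ρ m c = some d := by
  obtain ⟨k, rfl⟩ := Nat.exists_eq_add_of_le hmn
  rw [run_add] at h
  cases hm : run P w O ρ m c with
  | none => rw [hm] at h; simp at h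
  | some d => exact ⟨d, rfl⟩

/-- Two steps before the end of a live run the program counter is inside the program. [folklore] -/
theorem pc_lt_length_of_run {P : Program} {w : ℕ} {O : List ℕ → List ℕ} {ρ : ℕ → ℕ} {c d e : Cfg}
    {i : ℕ} (hi : run P w O ρ i c = some d) (hi2 : run P w O ρ (i + 2) c = some e) :
    ∃ p, d.pc = some p ∧ p < P.length := by
  rw [run_add, hi, Option.bind_some] at hi2
  cases hpc : d.pc with
  | none =>
    rw [run_succ, step_of_pc_eq_none hpc] at hi2; simp at hi2
  | some p =>
    refine ⟨p, rfl, ?_⟩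
    by_contra hp
    have hnone : P[p]? = none := List.getElem?_eq_none (by omega)
    rw [run_succ, step_of_getElem?_eq_none hpc hnone, Option.bind_some, run_one,
      step_of_pc_eq_none rfl] at hi2
    simp at hi2

/-! ## The state bound -/

/-- The number of steps within which a deterministic oracle-free program halts if it halts at
all: `|P| · (V + 1) ^ (V + 1) + 1` with `V = valueBound P w` (program counter `< |P|`, memory
`[0, V] → [0, V]`, plus the final step). [folklore] -/
def stateBound (P : Program) (w : ℕ) : ℕ :=
  P.length * (valueBound P w + 1) ^ (valueBound P w + 1) + 1

/-- Configurations of a deterministic oracle-free run agree as soon as their program counters and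
their memories on `[0, V]` agree. [folklore] -/
theorem cfg_eq_of_run {P : Program} (hd : P.IsDeterministic) (ho : P.IsOracleFree) {w : ℕ}
    {ρ : ℕ → ℕ} {x : List ℕ} {i j : ℕ} {cᵢ cⱼ : Cfg}
    (hi : run P w noOracle ρ i (init w x) = some cᵢ) (hj : run P w noOracle ρ j (init w x) = some cⱼ)
    (hpc : cᵢ.pc = cⱼ.pc) (hmem : ∀ a, a ≤ valueBound P w → cᵢ.mem a = cⱼ.mem a) : cᵢ = cⱼ := by
  obtain ⟨hci, hqi⟩ := run_coinPos_queries hd ho i hi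
  obtain ⟨hcj, hqj⟩ := run_coinPos_queries hd ho j hj
  have hV := two_pow_sub_one_le_valueBound P w
  have h1 := one_le_valueBound P w
  have hK := maxConst_le_valueBound P w
  have hinit := init_memLE w x hV
  cases cᵢ with
  | mk pci memi cpi qi =>
    cases cⱼ with
    | mk pcj memj cpj qj =>
      simp only at hpc hmem hci hqi hcj hqj ⊢
      subst hpc
      simp only [Cfg.mk.injEq, true_and]
      refine ⟨funext fun a => ?_, by rw [hci, hcj], by rw [hqi, hqj]⟩
      rcases le_or_gt a (valueBound P w) with ha | ha
      · exact hmem a ha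
      · have ei := iterate_step_mem_apply_of_lt hV h1 hK i hinit hi ha
        have ej := iterate_step_mem_apply_of_lt hV h1 hK j hinit hj ha
        simp only at ei ej
        rw [ei, ej]

/-- **Eventual periodicity (pigeonhole).** A deterministic oracle-free program that halts, halts
within `stateBound P w` steps: otherwise two of the first `|P| · (V+1)^(V+1) + 1` configurations
agree (program counter `< |P|`, memory `V`-bounded on `[0, V]` and fixed above `V`), the run is
periodic from there on, and never halts. [folklore] -/
theorem HaltsWithin.stateBound {P : Program} (hd : P.IsDeterministic) (ho : P.IsOracleFree)
    {w : ℕ} {O : List ℕ → List ℕ} {ρ : ℕ → ℕ} {x : List ℕ} {t : ℕ} {c : Cfg}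
    (h : HaltsWithin P w O ρ x t c) : HaltsWithin P w O ρ x (stateBound P w) c := by
  rw [haltsWithin_iff_of_isOracleFree ho w O noOracle] at h ⊢
  obtain ⟨s, -, hrun, hc⟩ := h.exists_run
  -- abbreviations
  set V := valueBound P w with hVdef
  set N := P.length * (V + 1) ^ (V + 1) with hN
  by_cases hs : s ≤ N + 1
  · exact haltsWithin_of_run hrun hc hs
  exfalso
  have hsN : N + 2 ≤ s := by omega
  -- the configurations of the run
  let cf : ℕ → Cfg := fun i => runTotal P w noOracle ρ i (init w x)
  have hlive : ∀ i, i ≤ s → run P w noOracle ρ i (init w x) = some (cf i) := fun i hi => by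
    obtain ⟨d, hd'⟩ := exists_run_of_le hrun hi
    show run P w noOracle ρ i (init w x) = some (runTotal P w noOracle ρ i (init w x))
    rw [hd', runTotal_of_run _ _ _ _ hd']
  have hpc : ∀ i, i ≤ N → ∃ p, (cf i).pc = some p ∧ p < P.length := fun i hi =>
    pc_lt_length_of_run (hlive i (by omega)) (hlive (i + 2) (by omega))
  have hmem : ∀ i, i ≤ N → MemLE V (cf i).mem := fun i hi =>
    memLE_of_iterate_init (n := i) (hlive i (by omega))
  -- the program is nonempty (the initial program counter `0` is inside it)
  have hP : 0 < P.length := by obtain ⟨p, -, hp⟩ := hpc 0 (Nat.zero_le _); omega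
  -- the coding of configurations
  let code : Fin (N + 1) → Fin P.length × (Fin (V + 1) → Fin (V + 1)) := fun i =>
    (⟨((cf i).pc.getD 0) % P.length, Nat.mod_lt _ hP⟩,
      fun a => ⟨(cf i).mem a % (V + 1), Nat.mod_lt _ (Nat.succ_pos _)⟩)
  have hcard : Fintype.card (Fin P.length × (Fin (V + 1) → Fin (V + 1))) <
      Fintype.card (Fin (N + 1)) := by
    simp only [Fintype.card_prod, Fintype.card_fin, Fintype.card_fun, hN]
    omega
  obtain ⟨i, j, hij, hcode⟩ := Fintype.exists_ne_map_eq_of_card_lt code hcard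
  -- WLOG `i < j`
  wlog hlt : i < j generalizing i j
  · exact this j i hij.symm hcode.symm (by omega)
  have hiN : (i : ℕ) ≤ N := Nat.lt_succ_iff.1 i.2
  have hjN : (j : ℕ) ≤ N := Nat.lt_succ_iff.1 j.2
  -- decode: the two configurations agree
  have heq : cf i = cf j := by
    simp only [code, Prod.mk.injEq, Fin.mk.injEq] at hcode
    obtain ⟨hc1, hc2⟩ := hcode
    obtain ⟨pi, hpi, hpi'⟩ := hpc i hiN
    obtain ⟨pj, hpj, hpj'⟩ := hpc j hjN
    refine cfg_eq_of_run hd ho (hlive i (by omega)) (hlive j (by omega)) ?_ fun a ha => ?_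
    · rw [hpi, hpj] at hc1 ⊢
      simp only [Option.getD_some] at hc1
      rw [Nat.mod_eq_of_lt hpi', Nat.mod_eq_of_lt hpj'] at hc1
      rw [hc1]
    · have := congr_fun hc2 ⟨a, Nat.lt_succ_of_le ha⟩
      simp only [Fin.mk.injEq] at this
      rwa [Nat.mod_eq_of_lt (Nat.lt_succ_of_le (hmem i hiN a)),
        Nat.mod_eq_of_lt (Nat.lt_succ_of_le (hmem j hjN a))] at this
  -- periodicity: the run at `s + (j - i)` is both halted (`none`) and equal to the run at `s`
  have hper : run P w noOracle ρ (s + (j - i)) (init w x) = run P w noOracle ρ s (init w x) := by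
    have e1 : s + (j - i) = j + (s - i) := by omega
    have e2 : s = i + (s - i) := by omega
    rw [e1, run_add, hlive j (by omega), Option.bind_some]
    conv_rhs => rw [e2, run_add, hlive i (by omega), Option.bind_some]
    rw [heq]
  rw [run_add, hrun, Option.bind_some] at hper
  obtain ⟨d, hd'⟩ : ∃ d, (j : ℕ) - i = d + 1 := ⟨(j : ℕ) - i - 1, by omega⟩
  rw [hd', show d + 1 = 1 + d from Nat.add_comm _ _, run_add, run_one, hc] at hper
  simp at hper

/-- What a deterministic oracle-free program outputs, it outputs within `stateBound P w` steps —
hence within any `T ≥ stateBound P w`. [folklore] -/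
theorem OutputsWithin.stateBound {P : Program} (hd : P.IsDeterministic) (ho : P.IsOracleFree)
    {w : ℕ} {O : List ℕ → List ℕ} {ρ : ℕ → ℕ} {x out : List ℕ} {t T : ℕ}
    (h : OutputsWithin P w O ρ x out t) (hT : stateBound P w ≤ T) : OutputsWithin P w O ρ x out T := by
  rw [outputsWithin_iff_exists_haltsWithin] at h ⊢
  obtain ⟨c, hc, hout⟩ := h
  exact ⟨c, (hc.stateBound hd ho).mono hT, hout⟩

/-- The state bound is monotone in any upper bound `V ≥ valueBound P w` of the values:
`stateBound P w ≤ |P| · (V + 1) ^ (V + 1) + 1`. [folklore] -/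
theorem stateBound_le {P : Program} {w V : ℕ} (hV : valueBound P w ≤ V) :
    stateBound P w ≤ P.length * (V + 1) ^ (V + 1) + 1 := by
  unfold stateBound
  have h1 : (valueBound P w + 1) ^ (valueBound P w + 1) ≤ (V + 1) ^ (valueBound P w + 1) :=
    Nat.pow_le_pow_left (by omega) _
  have h2 : (V + 1) ^ (valueBound P w + 1) ≤ (V + 1) ^ (V + 1) :=
    Nat.pow_le_pow_right (by omega) (by omega)
  have := Nat.mul_le_mul_left P.length (h1.trans h2)
  omega

end Literature.Computability.Cryptography.WordRAM
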